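import Summits.AnomalousDissipation.AnomalousDissipation.Theorems.SolenoidalFractalHomogenisationLagrangianStepZ7GlueDefsR
import Summits.AnomalousDissipation.AnomalousDissipation.Theorems.SolenoidalFractalHomogenisationLagrangianStepFrameConjugacyOfModulation
import Summits.AnomalousDissipation.AnomalousDissipation.Theorems.SolenoidalFractalHomogenisationLagrangianStepFrameModulationClosed
import Summits.AnomalousDissipation.AnomalousDissipation.Theorems.SolenoidalFractalHomogenisationLagrangianStepN1Window
import Summits.AnomalousDissipation.AnomalousDissipation.Theorems.SolenoidalFractalHomogenisationLagrangianStepCoarseSmoothCarrier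
import Summits.AnomalousDissipation.AnomalousDissipation.Theorems.SolenoidalFractalHomogenisationLagrangianStepOneLevelGlueLowerFamily
import Literature.Analysis.FluidPDE.PassiveVectorTensorPropagatorLossEnstrophy
import Literature.Analysis.FluidPDE.LagrangianLatticeCarrierLossMonotone
import HarnessLib

/-!
# K1L_D (stmt-AnomalousDissipation-27980): the registered stub `stub_Z7_alphaBetaR : Z7Glue.cellInputs_alphaBeta_textR` ASSEMBLED
# modulo ONE named input — the sharp frame-curvature bound K8-5 (`hcurv`) — as `Z7Glue.Z7_alphaBetaR_of_hcurv : HCURV → cellInputs_alphaBeta_textR`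
# (helper, `--supports 27980 --as helper`; prover ad-k1loc-p3 g9 = assembler of record, tenure RULING D27-7)

Per grid window `[jR, s′]` (`R = refresh (m+1)`, `r₁ = (j+1)R ≤ s′ ≤ jR + 2R`, `s′ ≤ 1`) the five conjuncts of the registered text come from:
* (α₁)/(α₂) `FrameConjugacyAt … (jR) r₁` and `… r₁ s′`: lead-k1l-onelevel-p1 g5's `FrameConj.frameConjugacyAt_of_modulation` (p706082; ONE input
  `hmod` on each CLOSED piece) ∘ this seat's `FrameForm.isModulation_frameG_closed` (p704979; here re-run with a POSITIVE constant,
  `isModulation_frameG_closed_pos`) ∘ THE HYPOTHESIS `HCURV` (K8-5, ad-k3l-bookkeeping lineage: `|∂_c (frameG)_{il}| ≤ C♯·N_m·strain m` on the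
  closed piece) — with `Cα := Cα₁ > 0`, `ϱ := (C♯+1)/Cα₁`, the Eulerian tensors' `NearIso` from `LagrangianStep.nearIso_renormStep` + `.smul`;
* (N1′)/(N1*′): ad-lit g29's R4′ `Torus.IsPropagator.loss_le_enstrophy'` / `lossAdj_le_enstrophy` (p706222) ∘ this seat's `N1Assembly.N1R_window{,_adj}`
  (p706596) with `CN := max 4 (4(|hi|/lo)·e^{12C′θ₀})` (`FrameForm.smoothCarrier_partialSum`, `window_exponent_le`, p705295);
* (N2): ad-lit g29's S7 `LevelRegular.loss_window_le` (p705946) with `Cmono := (|hi|/lo)·e^{12C′θ₀}`.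
Constants chosen before the carrier: `ν₁ = K₁ = 1`, `Λ₀ = 0`, `θ₀ = min` of the three design ceilings, `mstar = 0`.
When K8-5 lands as a theorem `K8_5 : HCURV`, `stub_Z7_alphaBetaR := Z7_alphaBetaR_of_hcurv K8_5` closes the registered stub BY NAME.
NOT a proof of K8-5, of the other two registered stubs, of K1L_D or of AD; rung F-D1.A0.
-/

set_option linter.dupNamespace false

noncomputable section

namespace Summit.AnomalousDissipation.AnomalousDissipation.Theorems.SolenoidalFractalHomogenisation.LagrangianStep.Z7Glue

open Literature.Analysis Literature.Analysis.FluidPDE Literature.Analysis.FunctionSpaces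
open MeasureTheory Set Filter UnitAddTorus
open scoped ENNReal NNReal InnerProductSpace
open Literature.Analysis.FluidPDE.LatticeShear (LagrangianLatticeCarrier LatticeWord)
open Summit.AnomalousDissipation.AnomalousDissipation.Theorems.SolenoidalFractalHomogenisation.LagrangianStep.CellClauseMod
open Summit.AnomalousDissipation.AnomalousDissipation.Theorems.SolenoidalFractalHomogenisation.LagrangianStep.FrameForm
open Summit.AnomalousDissipation.AnomalousDissipation.Theorems.SolenoidalFractalHomogenisation.LagrangianStep.FrameConj
open Summit.AnomalousDissipation.AnomalousDissipation.Theorems.SolenoidalFractalHomogenisation.LagrangianStep.N1Assembly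
open Summit.AnomalousDissipation.AnomalousDissipation.Theorems.SolenoidalFractalHomogenisation.LagrangianCarrierConstruction
open Summit.AnomalousDissipation.AnomalousDissipation.Theorems.SolenoidalFractalHomogenisation.LagrangianCarrier

/-! ## §1 `isModulation_frameG_closed` with a POSITIVE constant -/

/-- **`isModulation_frameG_closed` with `Cα > 0`** (same proof as `FrameForm.isModulation_frameG_closed` with the constant `5C + 6C′ + 1`; positivity is
what lets the sharp curvature bound `C♯·N_m·strain m` be read as `(Cα·strain m)·(ϱ·N_m)` with `ϱ = (C♯+1)/Cα`). -/
theorem isModulation_frameG_closed_pos (k : ℕ) (W : LatticeWord k) : ∃ θs : ℝ, 0 < θs ∧ ∃ Cα : ℝ, 0 < Cα ∧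
    ∀ (E : LagrangianLatticeCarrier k) (θ₀ : ℝ), E.design = W → θ₀ ≤ θs → E.LPermissible → E.Regular →
      (∀ m, E.N m ^ 2 ≤ E.N (m + 1)) → (∀ m, E.θ (m + 1) * ((E.N (m + 1) : ℝ) / E.N m) ^ (1 / 16 : ℝ) ≤ θ₀) →
      ∀ (m : ℕ) (j : ℤ) (t : ℝ), (j : ℝ) * E.refresh (m + 1) < t → t ≤ ((j : ℝ) + 1) * E.refresh (m + 1) → ∀ (nC : ℝ),
        (∀ u ∈ Icc 0 (t - (j : ℝ) * E.refresh (m + 1)), ∀ (y : UnitAddTorus (Fin 3)) (i l c : Fin 3),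
          |Torus.partialDeriv c (fun y => frameG E m ((j : ℝ) * E.refresh (m + 1) + u) ((j : ℝ) * E.refresh (m + 1)) y i l) y|
            ≤ (Cα * E.strain m) * nC) →
        IsModulation (Cα * E.strain m) (E.a (m + 1) * (t - (j : ℝ) * E.refresh (m + 1))) nC
          (fun τ y => frameG E m ((j : ℝ) * E.refresh (m + 1) + τ / E.a (m + 1)) ((j : ℝ) * E.refresh (m + 1)) y) := by
  obtain ⟨θ₁, hθ₁, C, hC, Hnear⟩ := abs_frameG_sub_one_le_strain_closed k W
  obtain ⟨θ₂, hθ₂, C', hC', Hrate⟩ := abs_partialDeriv_partialSum_le k W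
  set Cα : ℝ := 5 * C + 6 * C' + 1 with hCα
  have hCα0 : 0 < Cα := by rw [hCα]; positivity
  refine ⟨min (min θ₁ θ₂) (1 / (Cα + 1)), lt_min (lt_min hθ₁ hθ₂) (by positivity), Cα, hCα0, ?_⟩
  intro E θ₀ hD hθs hLP hReg hsq hT4 m j t hst htR nC hcurv
  have hθs₁ : θ₀ ≤ θ₁ := hθs.trans ((min_le_left _ _).trans (min_le_left _ _))
  have hθs₂ : θ₀ ≤ θ₂ := hθs.trans ((min_le_left _ _).trans (min_le_right _ _))
  have hθs₃ : θ₀ ≤ 1 / (Cα + 1) := hθs.trans (min_le_right _ _)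
  have hLR := hReg.levelRegular
  have hF : E.IsFlow m := (hLP.isLagrangian m).1
  set s : ℝ := (j : ℝ) * E.refresh (m + 1) with hs
  set S : ℝ := ∑ i ∈ Finset.range m, E.a (i + 1) with hS
  have hS0 : 0 ≤ S := Finset.sum_nonneg fun i _ => (E.toFractalCarrierData.a_pos _).le
  have hR0 : 0 < E.refresh (m + 1) := E.refresh_pos (m + 1)
  have hTR : t - s ≤ E.refresh (m + 1) := by rw [hs]; linarith
  have hNpos : ∀ m, (0 : ℝ) < E.N m := fun m => by exact_mod_cast E.toFractalCarrierData.N_pos m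
  have hN2 : ∀ m, 2 * E.N m ≤ E.N (m + 1) := hLP.permissible.2.2.1
  have hθm : E.θ (m + 1) ≤ θ₀ := by
    have hNmono : (E.N m : ℝ) ≤ E.N (m + 1) := by
      have h : (2 : ℝ) * E.N m ≤ E.N (m + 1) := by exact_mod_cast hN2 m
      linarith [hNpos m]
    have hr : (1 : ℝ) ≤ ((E.N (m + 1) : ℝ) / E.N m) ^ (1 / 16 : ℝ) :=
      Real.one_le_rpow ((one_le_div (hNpos m)).2 hNmono) (by norm_num)
    calc E.θ (m + 1) = E.θ (m + 1) * 1 := (mul_one _).symm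
      _ ≤ E.θ (m + 1) * ((E.N (m + 1) : ℝ) / E.N m) ^ (1 / 16 : ℝ) := mul_le_mul_of_nonneg_left hr (E.θ_pos _).le
      _ ≤ θ₀ := hT4 m
  have hstrain_def : E.strain m = S * E.refresh (m + 1) := by
    simp [LagrangianLatticeCarrier.strain, hS]
  have hstrain0 : 0 ≤ E.strain m := by rw [hstrain_def]; exact mul_nonneg hS0 hR0.le
  have hstrainθ : E.strain m ≤ θ₀ := (hLP.strain_le m).trans hθm
  have hθle1 : Cα * E.strain m ≤ 1 := by
    have h1 : Cα * θ₀ ≤ Cα * (1 / (Cα + 1)) := mul_le_mul_of_nonneg_left hθs₃ hCα0.le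
    have h2 : Cα * (1 / (Cα + 1)) ≤ 1 := by
      rw [mul_one_div, div_le_one (by positivity)]; linarith
    nlinarith [mul_le_mul_of_nonneg_left hstrainθ hCα0.le]
  have hθ0 : 0 ≤ Cα * E.strain m := mul_nonneg hCα0.le hstrain0
  have hSw : ∀ u ∈ Icc 0 (t - s), S * u ≤ E.strain m := fun u hu => by
    rw [hstrain_def]; exact mul_le_mul_of_nonneg_left (hu.2.trans hTR) hS0
  have hnear : ∀ u ∈ Icc 0 (t - s), ∀ (y : UnitAddTorus (Fin 3)) (i l : Fin 3),
      |frameG E m (s + u) s y i l - (1 : Matrix (Fin 3) (Fin 3) ℝ) i l| ≤ Cα * E.strain m := by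
    intro u hu y i l
    have h := Hnear E θ₀ hD hθs₁ hLP hReg hsq hT4 m j (s + u) (by rw [hs]; linarith [hu.1])
      (by rw [hs]; nlinarith [hu.2, hTR]) y i l
    have h5 : 5 * C * (S * (s + u - (j : ℝ) * E.refresh (m + 1))) ≤ 5 * C * E.strain m := by
      refine mul_le_mul_of_nonneg_left ?_ (by positivity)
      have e : s + u - (j : ℝ) * E.refresh (m + 1) = u := by rw [hs]; ring
      rw [e]; exact hSw u hu
    have h6 : 5 * C * E.strain m ≤ Cα * E.strain m := by
      rw [hCα]; nlinarith [mul_nonneg hC' hstrain0]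
    exact h.trans (h5.trans h6)
  have hrate : ∀ u ∈ Icc 0 (t - s), ∀ (y : UnitAddTorus (Fin 3)) (a q : Fin 3),
      |Torus.partialDeriv q (fun z => E.partialSum m (s + u) z a) (E.X m (s + u) s y)| ≤ C' * S :=
    fun u _ y a q => Hrate E θ₀ hD hθs₂ hLP hReg hsq hT4 m (s + u) _ a q
  have hbudget : 3 * (1 + Cα * E.strain m) * (C' * S) * (t - s) ≤ Cα * E.strain m := by
    have hsw : S * (t - s) ≤ E.strain m := hSw (t - s) ⟨by linarith, le_rfl⟩
    have h1 : 3 * (1 + Cα * E.strain m) * (C' * S) * (t - s) ≤ 6 * C' * (S * (t - s)) := by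
      have : (1 + Cα * E.strain m) ≤ 2 := by linarith
      have hSt : 0 ≤ S * (t - s) := mul_nonneg hS0 (by linarith)
      nlinarith [mul_nonneg hC' hSt]
    have h2 : 6 * C' * (S * (t - s)) ≤ 6 * C' * E.strain m := mul_le_mul_of_nonneg_left hsw (by positivity)
    have h3 : 6 * C' * E.strain m ≤ Cα * E.strain m := by rw [hCα]; nlinarith [mul_nonneg hC hstrain0]
    linarith
  exact isModulation_frameG_of_closed E hLR hF j hst hTR hθ0 (mul_nonneg hC' hS0) hnear hrate hbudget
    (fun u hu i => isDivFree_frameG_col_closed E hLR hF j hTR hu i) hcurv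

/-! ## §2 Small facts -/

/-- The mode set `(freqBall L).erase 0` is symmetric. -/
theorem neg_mem_erase_freqBall {L : ℕ} {Sf : Finset (Fin 3 → ℤ)} (hSf : Sf = (Torus.freqBall L).erase 0) :
    ∀ k' ∈ Sf, -k' ∈ Sf := by
  intro k' hk'
  rw [hSf, Finset.mem_erase] at hk' ⊢
  exact ⟨neg_ne_zero.2 hk'.1, Torus.neg_mem_freqBall_of_mem k' hk'.2⟩

/-! ## §3 THE ASSEMBLY modulo K8-5 -/

/-- **`stub_Z7_alphaBetaR` MODULO K8-5.**  The registered αβ text `Z7Glue.cellInputs_alphaBeta_textR` from the sharp frame-curvature bound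
`HCURV` (the K8-5 text: for every design, constants `θs, C♯` such that on every closed refresh piece `|∂_c (frameG)_{il}| ≤ C♯·N_m·strain m`). -/
theorem Z7_alphaBetaR_of_hcurv
    (HCURV : ∀ (k : ℕ) (W : LatticeWord k), ∃ θs : ℝ, 0 < θs ∧ ∃ Cs : ℝ, 0 ≤ Cs ∧
      ∀ (E : LagrangianLatticeCarrier k) (θ₀ : ℝ), E.design = W → θ₀ ≤ θs → E.LPermissible → E.Regular →
        (∀ m, E.N m ^ 2 ≤ E.N (m + 1)) → (∀ m, E.θ (m + 1) * ((E.N (m + 1) : ℝ) / E.N m) ^ (1 / 16 : ℝ) ≤ θ₀) →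
        ∀ (m : ℕ) (j : ℤ) (t : ℝ), (j : ℝ) * E.refresh (m + 1) < t → t ≤ ((j : ℝ) + 1) * E.refresh (m + 1) →
          ∀ u ∈ Set.Icc 0 (t - (j : ℝ) * E.refresh (m + 1)), ∀ (y : UnitAddTorus (Fin 3)) (i l c : Fin 3),
            |Torus.partialDeriv c (fun y => frameG E m ((j : ℝ) * E.refresh (m + 1) + u) ((j : ℝ) * E.refresh (m + 1)) y i l) y|
              ≤ Cs * E.N m * E.strain m) :
    cellInputs_alphaBeta_textR := by
  intro k W M hM c hc Φ lo hi Λ β σ C ν₀ K Cf νf Kf hlo hlo1 hhi hΛ hβ hσ hC hν₀ hK hV hCf hνf hKf hF hH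
  -- the design's three ceilings and constants
  obtain ⟨θs₁, hθs₁, Cα, hCα, Hmod⟩ := isModulation_frameG_closed_pos k (W.stretch M hM)
  obtain ⟨θs₂, hθs₂, Cs, hCs, Hcurv⟩ := HCURV k (W.stretch M hM)
  obtain ⟨θs₃, hθs₃, C', hC', Hcar⟩ := smoothCarrier_partialSum k (W.stretch M hM)
  set θ₀ : ℝ := min (min θs₁ θs₂) θs₃ with hθ₀def
  have hθ₀ : 0 < θ₀ := lt_min (lt_min hθs₁ hθs₂) hθs₃
  set ϱ : ℝ := (Cs + 1) / Cα with hϱdef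
  have hϱ : 0 < ϱ := by rw [hϱdef]; positivity
  set Cexp : ℝ := 12 * C' * θ₀ with hCexpdef
  set CN : ℝ := max 4 (4 * (|hi| / lo) * Real.exp Cexp) with hCNdef
  have hCN : 0 < CN := lt_of_lt_of_le (by norm_num) (le_max_left _ _)
  set Cmono : ℝ := |hi| / lo * Real.exp Cexp with hCmonodef
  have hCmono : 0 < Cmono := by
    rw [hCmonodef]
    have : 0 < |hi| := abs_pos.2 (by linarith)
    positivity
  refine ⟨1, one_pos, 1, one_pos, 0, θ₀, hθ₀, Cα, hCα, ϱ, hϱ, CN, hCN, Cmono, hCmono, ?_⟩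
  intro E hdes hgain hnu0 hKE hLP hReg hT1 hN2 hT2 hT3 hT4 hT5
  refine ⟨0, fun m _ => ?_⟩
  intro Lc hLc S hSo hSn hΦSo hΦSn Um Um1 hUm hUm1 Sf hSf j s' h1 h2 h3
  -- level data
  have hP := hLP.permissible
  have hLR := hReg.levelRegular
  set R : ℝ := E.refresh (m + 1) with hRdef
  have hR : 0 < R := E.refresh_pos (m + 1)
  set ν : ℝ := E.cellVisc (m + 1) with hνdef
  have hν : 0 < ν := LagrangianRenormalisationStep.cellVisc_pos' E.toFractalCarrierData (m + 1)
  have hj0 : 0 ≤ (j : ℝ) * R := mul_nonneg (Nat.cast_nonneg j) hR.le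
  have hκ0 : 0 < E.kbar m := E.kbar_pos m
  have hκ1 : 0 < E.kbar (m + 1) := E.kbar_pos (m + 1)
  have hg : 0 ≤ E.gain / ν ^ 2 := div_nonneg (by rw [hgain]; exact hc.le) (sq_nonneg _)
  have hθ₀₁ : θ₀ ≤ θs₁ := (min_le_left _ _).trans (min_le_left _ _)
  have hθ₀₂ : θ₀ ≤ θs₂ := (min_le_left _ _).trans (min_le_right _ _)
  have hθ₀₃ : θ₀ ≤ θs₃ := min_le_right _ _
  -- the two Eulerian tensors are elliptic
  have h𝔸1 : Torus.NearIso (E.kbar (m + 1) • S) (E.kbar (m + 1) * lo) (E.kbar (m + 1) * hi) := hSn.smul hκ1.le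
  have hlo₁ : 0 < E.kbar (m + 1) * lo := mul_pos hκ1 hlo
  have h𝔸0 : Torus.NearIso (E.kbar m • renormStep (Φ ν) (E.gain / ν ^ 2) S) (E.kbar m * lo) (E.kbar m * hi) :=
    (nearIso_renormStep hg hSn hΦSn).smul hκ0.le
  have hlo₀ : 0 < E.kbar m * lo := mul_pos hκ0 hlo
  -- strain bookkeeping
  have hstrain0 : 0 ≤ E.strain m := by
    unfold LagrangianLatticeCarrier.strain
    exact mul_nonneg (Finset.sum_nonneg fun i _ => (E.toFractalCarrierData.a_pos (i + 1)).le) (E.refresh_pos (m + 1)).le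
  have hNm : (0 : ℝ) < E.N m := by exact_mod_cast E.N_pos m
  -- hmod on a closed piece `[j'R, t]` from HCURV
  have hmod : ∀ (j' : ℕ) (t : ℝ), (j' : ℝ) * R < t → t ≤ ((j' : ℝ) + 1) * R →
      IsModulation (Cα * E.strain m) (E.a (m + 1) * (t - (j' : ℝ) * R)) (ϱ * E.N m)
        (fun τ y => frameG E m ((j' : ℝ) * R + τ / E.a (m + 1)) ((j' : ℝ) * R) y) := by
    intro j' t hjt htR
    have hc' : ∀ u ∈ Icc 0 (t - ((j' : ℤ) : ℝ) * E.refresh (m + 1)), ∀ (y : UnitAddTorus (Fin 3)) (i l c : Fin 3),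
        |Torus.partialDeriv c (fun y => frameG E m (((j' : ℤ) : ℝ) * E.refresh (m + 1) + u) (((j' : ℤ) : ℝ) * E.refresh (m + 1)) y i l) y|
          ≤ (Cα * E.strain m) * (ϱ * E.N m) := by
      intro u hu y i l c'
      have h := Hcurv E θ₀ hdes hθ₀₂ hLP hReg hN2 hT4 m (j' : ℤ) t (by push_cast; exact hjt) (by push_cast; exact htR) u hu y i l c'
      refine h.trans ?_
      have e : Cα * E.strain m * (ϱ * E.N m) = (Cs + 1) * E.N m * E.strain m := by
        rw [hϱdef]; field_simp
      rw [e]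
      exact mul_le_mul_of_nonneg_right (mul_le_mul_of_nonneg_right (by linarith) hNm.le) hstrain0
    have h := Hmod E θ₀ hdes hθ₀₁ hLP hReg hN2 hT4 m (j' : ℤ) t (by push_cast; exact hjt) (by push_cast; exact htR) (ϱ * E.N m) hc'
    push_cast at h
    exact h
  have hθle : Cα * E.strain m ≤ Cα * E.θ (m + 1) := mul_le_mul_of_nonneg_left (hLP.strain_le m) hCα.le
  have hθ0 : 0 ≤ Cα * E.strain m := mul_nonneg hCα.le hstrain0
  -- the smooth carrier and the window exponent
  obtain ⟨Mb, hb⟩ := Hcar E θ₀ hdes hθ₀₃ hLP hReg hN2 hT4 m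
  have hexp : 2 * ((Fintype.card (Fin 3) : ℝ) * (C' * ∑ i ∈ Finset.range m, E.a (i + 1))) * (2 * R) ≤ Cexp :=
    window_exponent_le E hLP hC' hT4 m
  have hG0 : 0 ≤ C' * ∑ i ∈ Finset.range m, E.a (i + 1) :=
    mul_nonneg hC' (Finset.sum_nonneg fun i _ => (E.toFractalCarrierData.a_pos (i + 1)).le)
  refine ⟨?_, ?_, ?_, ?_, ?_⟩
  · -- (α₁) on `[jR, (j+1)R]`
    have e : ((j : ℝ) + 1) * R = (j : ℝ) * R + R := by ring
    have hjt : (j : ℝ) * R < ((j : ℝ) + 1) * R := by rw [e]; exact lt_add_of_pos_right _ hR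
    have ht1 : ((j : ℝ) + 1) * R ≤ 1 := by rw [e]; exact h1.trans h3
    have h := frameConjugacyAt_of_modulation E hLP hLR hdes Φ m j S hj0 hjt e.le ht1 hν hθ0 hθle hϱ.le
      (hmod j _ hjt le_rfl) hUm1 hUm h𝔸1 hlo₁ h𝔸0 hlo₀
    rw [hgain] at h
    exact h
  · -- (α₂) on `[(j+1)R, s']`
    intro hlt
    have e1 : ((j : ℝ) + 1) * R = ((j + 1 : ℕ) : ℝ) * R := by push_cast; ring
    have hj0' : 0 ≤ ((j + 1 : ℕ) : ℝ) * R := mul_nonneg (Nat.cast_nonneg _) hR.le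
    have hjt : ((j + 1 : ℕ) : ℝ) * R < s' := by rw [← e1]; exact hlt
    have e2 : ((j + 1 : ℕ) : ℝ) * R + R = (j : ℝ) * R + 2 * R := by push_cast; ring
    have e3 : (((j + 1 : ℕ) : ℝ) + 1) * R = (j : ℝ) * R + 2 * R := by push_cast; ring
    have htR : s' ≤ ((j + 1 : ℕ) : ℝ) * R + R := by rw [e2]; exact h2
    have htR' : s' ≤ (((j + 1 : ℕ) : ℝ) + 1) * R := by rw [e3]; exact h2
    have h := frameConjugacyAt_of_modulation E hLP hLR hdes Φ m (j + 1) S hj0' hjt htR h3 hν hθ0 hθle hϱ.le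
      (hmod (j + 1) s' hjt htR') hUm1 hUm h𝔸1 hlo₁ h𝔸0 hlo₀
    rw [hgain, ← e1] at h
    exact h
  · -- (N1′)
    intro x hx
    have hτ : (j : ℝ) * R < s' := lt_of_lt_of_le (lt_add_of_pos_right _ hR) h1
    have hCz : 2 * |E.kbar m * hi| * (s' - (j : ℝ) * R) * Real.exp (2 * ((Fintype.card (Fin 3) : ℝ) *
        (C' * ∑ i ∈ Finset.range m, E.a (i + 1))) * (s' - (j : ℝ) * R)) ≤ 2 * (E.kbar m * |hi|) * (s' - (j : ℝ) * R) * Real.exp Cexp := by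
      rw [abs_mul, abs_of_pos hκ0]
      refine mul_le_mul_of_nonneg_left (Real.exp_le_exp.2 ?_) (by have := sub_pos.2 hτ; positivity)
      refine le_trans ?_ hexp
      have hτ2 : s' - (j : ℝ) * R ≤ 2 * R := sub_le_iff_le_add'.2 h2
      exact mul_le_mul_of_nonneg_left hτ2 (by positivity)
    refine N1R_window E hP m hlo hgain (U := Um ((j : ℝ) * R) s') (fun y => hUm.norm_le _ _ y) hτ hCz ?_
      (neg_mem_erase_freqBall hSf) x hx
    intro y hy hZ
    exact hUm.loss_le_enstrophy' h𝔸0 hlo₀ hb hj0 hτ.le h3 y hy hZ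
  · -- (N1*′)
    intro y hy
    have hτ : (j : ℝ) * R < s' := lt_of_lt_of_le (lt_add_of_pos_right _ hR) h1
    have hCz : 2 * |E.kbar m * hi| * (s' - (j : ℝ) * R) * Real.exp (2 * ((Fintype.card (Fin 3) : ℝ) *
        (C' * ∑ i ∈ Finset.range m, E.a (i + 1))) * (s' - (j : ℝ) * R)) ≤ 2 * (E.kbar m * |hi|) * (s' - (j : ℝ) * R) * Real.exp Cexp := by
      rw [abs_mul, abs_of_pos hκ0]
      refine mul_le_mul_of_nonneg_left (Real.exp_le_exp.2 ?_) (by have := sub_pos.2 hτ; positivity)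
      refine le_trans ?_ hexp
      have hτ2 : s' - (j : ℝ) * R ≤ 2 * R := sub_le_iff_le_add'.2 h2
      exact mul_le_mul_of_nonneg_left hτ2 (by positivity)
    refine N1R_window_adj E hP m hlo hgain (U := Um ((j : ℝ) * R) s') (fun z => hUm.norm_le _ _ z) hτ hCz ?_
      (neg_mem_erase_freqBall hSf) y hy
    intro z hz hZ
    have h := hUm.lossAdj_le_enstrophy h𝔸0 hlo₀ hb hj0 hτ.le h3 (Lp.memLp z) hz hZ
    rwa [Lp.toLp_coeFn z (Lp.memLp z)] at h
  · -- (N2)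
    intro x
    have e1 : ((j : ℝ) + 1) * R = (j : ℝ) * R + R := by ring
    have hG : ∀ (t : ℝ) (x : UnitAddTorus (Fin 3)) (c a : Fin 3),
        |FunctionSpaces.Torus.partialDeriv c (E.partialSum m t) x a| ≤ C' * ∑ i ∈ Finset.range m, E.a (i + 1) := hb.grad_le
    have h := hLR.loss_window_le m hG0 hG h𝔸0 hlo₀ hUm hj0 hR h1 h2 h3 x
    rw [e1]
    unfold lossFwd
    refine h.trans ?_
    have hloss : 0 ≤ ‖x‖ ^ 2 - ‖Um ((j : ℝ) * R) ((j : ℝ) * R + R) x‖ ^ 2 := LossCurrency.loss_nonneg (fun y => hUm.norm_le _ _ y) x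
    have hratio : 0 ≤ (s' - ((j : ℝ) * R + R)) / R := div_nonneg (sub_nonneg.2 h1) hR.le
    have hc1 : |E.kbar m * hi| / (E.kbar m * lo) * Real.exp (12 * (C' * ∑ i ∈ Finset.range m, E.a (i + 1)) * R) ≤ Cmono := by
      rw [hCmonodef, abs_mul, abs_of_pos hκ0, mul_div_mul_left _ _ hκ0.ne']
      refine mul_le_mul_of_nonneg_left (Real.exp_le_exp.2 ?_) (by positivity)
      have h12 : 12 * (C' * ∑ i ∈ Finset.range m, E.a (i + 1)) * R =
          2 * ((Fintype.card (Fin 3) : ℝ) * (C' * ∑ i ∈ Finset.range m, E.a (i + 1))) * (2 * R) := by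
        simp only [Fintype.card_fin, Nat.cast_ofNat]; ring
      rw [h12]; exact hexp
    exact mul_le_mul_of_nonneg_right (mul_le_mul_of_nonneg_right hc1 hratio) hloss

end Summit.AnomalousDissipation.AnomalousDissipation.Theorems.SolenoidalFractalHomogenisation.LagrangianStep.Z7Glue

end
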